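import Literature.IUT.LogThetaLattice.VerticallyCoricLGPKummer
import Literature.IUT.LogThetaLattice.VerticallyCoricLGPPackets
import Literature.IUT.LogVolume.LocalUnitLogEquivariance
import HarnessLib

/-!
# [IUTchIII] Proposition 3.5 (i) ⟶ (ii)(a): the CONSTRUCTED Kummer isomorphisms are functorial, carry the packet
# log-shells `𝓘(^{S^±_{j+1},j}𝓕_v)` onto one another, and satisfy (ii)(a) — proof-only companion of
# `VerticallyCoricLGPKummer.lean`

S. Mochizuki, *Inter-universal Teichmüller theory III*, kurims manuscript (May 2020) `paper:url-4b091feeb646`, §3,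
Proposition 3.5 (i) p. 103 l. 35 – p. 104 l. 28, (ii)(a) p. 104 l. 36 – p. 105 l. 10, Proposition 3.2 (i)/(ii) p. 98–99
(PRIMS offset ≈ +420) [claim: Mochizuki2012, status: disputed] for every quoted sentence; abc-iut cell, layer L6, seat
abc-iut-L6-t4 (typer of record of [IUTchIII] §3; gen 5). PROOF-ONLY (no `def`, no instance, no named fact) companion of
`VerticallyCoricLGPKummer.lean` (p432850: `PacketAt.congrAlg`, `lgpPacketCongr`, `VerticallyCoricLGPData.ofKummer` — the Kummer
isomorphisms of Prop. 3.5 (i) as the packet transports induced by the Kummer isomorphisms of labeled data), of my gen-2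
`VerticallyCoricLGPPackets.lean` (p409844: Prop. 3.5 (ii)(a) at the packet, the Kummer isomorphism read as "the units in the
coric copy") and of abc-iut-w5-d242's `LocalUnitLogEquivariance.lean` (p413998/p414349: an isometric field isomorphism carries
the genuine log-shell `ℐ_K = (p*)⁻¹·log_p(𝒪^×_K)` onto `ℐ_{K'}`).

WHAT IS PROVED.
* §1 FUNCTORIALITY of the packet isomorphism ("functorial algorithm", p. 104 l. 2): `PacketAt.congrAlg_refl` (identity ↦
  identity), `PacketAt.congrAlg_trans` (composites ↦ composites), `PacketAt.congrAlg_symm` (inverses ↦ inverses); and the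
  JUNCTION WITH PROP. 3.2 (i): on underlying modules the packet isomorphism IS my gen-0 compatibility isomorphism
  `MPacketAt.compat` of Prop. 3.2 (i) ("induce natural [poly-]isomorphisms … between the various mono-analytic tensor packets
  … and the holomorphic tensor packets", p. 98) at the underlying linear isomorphisms — `PacketAt.congrAlg_toLinearEquiv`.
* §2–§3 LOG-SHELLS: the packet isomorphism carries the packet log-shell `𝓘(^{A,α}𝒟^⊢_v)` (gen-0 `shellPacketAt`, Prop. 3.2 (ii):
  generated by the tensors of shell elements) built from additive subgroups `I` ONTO the one built from `I'` as soon as the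
  factor isomorphisms carry `I` onto `I'` (`map_shellPacketAt_congrAlg`, `_closure`); hence the Kummer transport of (i) carries
  `𝓘(^{S^±_{j+1},j;(n,m−1)}𝓕_v)` (gen 4's `lgpShell`) ONTO the coric `𝓘(^{S^±_{j+1},j}𝓕(^{n,∘}𝔇_≻)_v)` whenever the identifications
  `e_w` carry log-shells onto log-shells (`map_lgpShell_lgpPacketCongr`) — DISCHARGED at the GENUINE `p`-adic logarithms
  (`PadicLogOnUnits.ofUnitLog`) for ISOMETRIC `e_w` by abc-iut-w5-d242's `image_logShell_ofUnitLog`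
  (`map_lgpShell_lgpPacketCongr_ofUnitLog`) — Prop. 3.2 (ii) last sentence "with `𝒟^⊢` replaced by `𝓕` … by applying the
  natural poly-isomorphisms".
* §4 **PROP. 3.5 (ii)(a) FOR THE KUMMER ISOMORPHISMS CONSTRUCTED IN (i)**: `prop35ii_a_lgpPacketCongr_ofUnitLog` — my gen-0 predicate
  `Prop35ii_a` (p. 104–105: "the topological module `𝓘(^{S^±_{j+1}}𝓕(^{n,∘}𝔇_≻)_{v_ℚ})` … contains the images … of the groups of units
  … via both the tensor product … of the [relevant] Kummer isomorphisms of (i), and the tensor product … of the pre-composite of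
  these Kummer isomorphisms with the `m'`-th iterates … of the log-links, for `m' ≥ 1`") HOLDS with `X :=` the CORIC label-`j`
  packet, `I :=` its genuine log-shell, `U m := ∏ 𝒪^×` of the index-`m` Frobenius-like fields and **`κ m :=` the packet
  transport `lgpPacketCongr (e m)` of p432850** (not the identity reading of p409844), for every isometric family of
  identifications `e m w : Km m w ≃ₐ[ℚ_p] K w` — by my gen-2 `prop35ii_a_shellPacketAt_ofUnitLog` (p409844) in the index-`m`
  copy followed by §3.
* §5 functoriality of the Kummer transports (`lgpPacketCongr_trans/_symm`, `PacketAt.congrAlg_refl`); the composite "index `m` ⥲ coric ⥲ index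
  `m'`" of two Kummer isomorphisms of `ofKummer` is the transport along `e_{m'}⁻¹ ∘ e_m`
  (`VerticallyCoricLGPData.ofKummer_kummer_trans_eq_congr`) — the cocycle behind the "translation symmetries" of p. 106.

HONEST SCOPE: the isometry hypothesis `he` is the classical "uniqueness of the extended absolute value" (every `ℚ_p`-algebra
isomorphism of `p`-adic fields is isometric; abc-iut-w5-d242's `norm_map_algEquiv` discharges it for algebraic `K/ℚ_p`) and is
kept as a named hypothesis on the INPUT identifications; archimedean places and (ii)(b)/(c) are not touched here. Nothing
here asserts abc proved or refuted or takes a side on [IUTchIII] Cor. 3.12; typed ≠ proved elsewhere; covered ≠ endorsed.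
-/

noncomputable section

namespace Literature.IUT.LogThetaLattice

open Set Metric
open scoped TensorProduct
open PiTensorProduct
open Literature.IUT.HodgeArakelov Literature.AnabelianGeometry.AbsoluteAnabelian

universe u v v' w w' w₃

/-! ### 1. Functoriality of the packet isomorphism (identity, composition, inverse) -/

section Functorial

variable (𝕜 : Type u) [Field 𝕜] {A : Type v} {Vfib : Type v'}
variable (L : A → Vfib → Type w) [∀ α v, CommRing (L α v)] [∀ α v, Algebra 𝕜 (L α v)]
variable (L' : A → Vfib → Type w') [∀ α v, CommRing (L' α v)] [∀ α v, Algebra 𝕜 (L' α v)]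
variable (L'' : A → Vfib → Type w₃) [∀ α v, CommRing (L'' α v)] [∀ α v, Algebra 𝕜 (L'' α v)]

/-- **Functoriality, identity**: the packet isomorphism induced by the identity identifications is the identity ("functorial
algorithm", [IUTchIII] Prop. 3.5 (i) p. 104 l. 2; Prop. 3.1 (ii) p. 93). PROVED (linear extensionality on pure tensors).
[cite: Mochizuki2012, Prop. 3.5 (i) p.104] [claim: Mochizuki2012, status: disputed] -/
theorem PacketAt.congrAlg_refl (α : A) (v : Vfib) :
    PacketAt.congrAlg 𝕜 L L (fun _ _ => AlgEquiv.refl) α v = AlgEquiv.refl := by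
  apply AlgEquiv.toLinearMap_injective
  apply TensorProduct.ext'
  intro x z
  induction z using PiTensorProduct.induction_on with
  | smul_tprod r y =>
    rw [TensorProduct.tmul_smul, LinearMap.map_smul, LinearMap.map_smul]
    congr 1
    change PacketAt.congrAlg 𝕜 L L (fun _ _ => AlgEquiv.refl) α v (x ⊗ₜ[𝕜] tprod 𝕜 y) = x ⊗ₜ[𝕜] tprod 𝕜 y
    rw [PacketAt.congrAlg_tmul_tprod]
    rfl
  | add z₁ z₂ h₁ h₂ => rw [TensorProduct.tmul_add, LinearMap.map_add, LinearMap.map_add, h₁, h₂]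

/-- **Functoriality, composition**: the packet isomorphism induced by composite identifications `e' ∘ e` is the composite of
the packet isomorphisms. PROVED. [cite: Mochizuki2012, Prop. 3.5 (i) p.104] [claim: Mochizuki2012, status: disputed] -/
theorem PacketAt.congrAlg_trans (e : ∀ α v, L α v ≃ₐ[𝕜] L' α v) (e' : ∀ α v, L' α v ≃ₐ[𝕜] L'' α v)
    (α : A) (v : Vfib) :
    PacketAt.congrAlg 𝕜 L L'' (fun α v => (e α v).trans (e' α v)) α v =
      (PacketAt.congrAlg 𝕜 L L' e α v).trans (PacketAt.congrAlg 𝕜 L' L'' e' α v) := by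
  apply AlgEquiv.toLinearMap_injective
  apply TensorProduct.ext'
  intro x z
  induction z using PiTensorProduct.induction_on with
  | smul_tprod r y =>
    rw [TensorProduct.tmul_smul, LinearMap.map_smul, LinearMap.map_smul]
    congr 1
    change PacketAt.congrAlg 𝕜 L L'' (fun α v => (e α v).trans (e' α v)) α v (x ⊗ₜ[𝕜] tprod 𝕜 y) =
      PacketAt.congrAlg 𝕜 L' L'' e' α v (PacketAt.congrAlg 𝕜 L L' e α v (x ⊗ₜ[𝕜] tprod 𝕜 y))
    rw [PacketAt.congrAlg_tmul_tprod, PacketAt.congrAlg_tmul_tprod, PacketAt.congrAlg_tmul_tprod]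
    rfl
  | add z₁ z₂ h₁ h₂ => rw [TensorProduct.tmul_add, LinearMap.map_add, LinearMap.map_add, h₁, h₂]

/-- **Functoriality, inverses**: the inverse packet isomorphism is the one induced by the inverse identifications. PROVED.
[cite: Mochizuki2012, Prop. 3.5 (i) p.104] [claim: Mochizuki2012, status: disputed] -/
theorem PacketAt.congrAlg_symm (e : ∀ α v, L α v ≃ₐ[𝕜] L' α v) (α : A) (v : Vfib) :
    (PacketAt.congrAlg 𝕜 L L' e α v).symm = PacketAt.congrAlg 𝕜 L' L (fun α v => (e α v).symm) α v := by
  have h : (PacketAt.congrAlg 𝕜 L' L (fun α v => (e α v).symm) α v).trans (PacketAt.congrAlg 𝕜 L L' e α v) =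
      AlgEquiv.refl := by
    rw [← PacketAt.congrAlg_trans]
    have : (fun α v => ((e α v).symm.trans (e α v))) = fun α v => (AlgEquiv.refl : L' α v ≃ₐ[𝕜] L' α v) := by
      funext α v
      ext x
      exact (e α v).apply_symm_apply x
    rw [this, PacketAt.congrAlg_refl]
  apply AlgEquiv.ext
  intro t
  apply (PacketAt.congrAlg 𝕜 L L' e α v).injective
  rw [AlgEquiv.apply_symm_apply, ← AlgEquiv.trans_apply, h]
  rfl

end Functorial

section Compat

variable (𝕜 : Type u) [Field 𝕜] {A : Type v} {Vfib : Type v'}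
variable (L : A → Vfib → Type w) [∀ α v, CommRing (L α v)] [∀ α v, Algebra 𝕜 (L α v)]
variable (L' : A → Vfib → Type w) [∀ α v, CommRing (L' α v)] [∀ α v, Algebra 𝕜 (L' α v)]

/-- **JUNCTION WITH [IUTchIII] Prop. 3.2 (i)** ("(Mono-analytic/Holomorphic Compatibility)", p. 98: a family of isomorphisms of
the factors "induce[s] natural … isomorphisms … `log(^{A,α}𝒟^⊢_v) ⥲ log(^{A,α}𝓕_v)`"): on underlying `𝕜`-modules the packet algebra
isomorphism `PacketAt.congrAlg e` (p432850) IS my gen-0 compatibility isomorphism `MPacketAt.compat` (p403825) at the underlying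
linear isomorphisms `(e α v).toLinearEquiv`. PROVED (both are `e ⊗ (⊗_β ∏_w e)` on pure tensors).
[cite: Mochizuki2012, Prop. 3.2 (i) p.98] [claim: Mochizuki2012, status: disputed] -/
theorem PacketAt.congrAlg_toLinearEquiv (e : ∀ α v, L α v ≃ₐ[𝕜] L' α v) (α : A) (v : Vfib) :
    (PacketAt.congrAlg 𝕜 L L' e α v).toLinearEquiv =
      MPacketAt.compat (𝕜 := 𝕜) (D := L) (L := L') (fun α v => (e α v).toLinearEquiv) α v := by
  apply LinearEquiv.toLinearMap_injective
  apply TensorProduct.ext'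
  intro x z
  induction z using PiTensorProduct.induction_on with
  | smul_tprod r y =>
    rw [TensorProduct.tmul_smul, LinearMap.map_smul, LinearMap.map_smul]
    congr 1
  | add z₁ z₂ h₁ h₂ => rw [TensorProduct.tmul_add, LinearMap.map_add, LinearMap.map_add, h₁, h₂]

end Compat

/-! ### 2. The packet isomorphism carries the packet log-shell onto the packet log-shell -/

section Shells

variable (𝕜 : Type u) [Field 𝕜] {A : Type v} {Vfib : Type v'}
variable (L : A → Vfib → Type w) [∀ α v, CommRing (L α v)] [∀ α v, Algebra 𝕜 (L α v)]
variable (L' : A → Vfib → Type w') [∀ α v, CommRing (L' α v)] [∀ α v, Algebra 𝕜 (L' α v)]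
variable (e : ∀ α v, L α v ≃ₐ[𝕜] L' α v)
variable (I : ∀ α v, AddSubgroup (L α v)) (I' : ∀ α v, AddSubgroup (L' α v))

/-- **The packet isomorphism carries the packet log-shell ONTO the packet log-shell** ([IUTchIII] Prop. 3.2 (ii) p. 98–99:
`𝓘(^{A,α}𝒟^⊢_v) ⊆ log(^{A,α}𝒟^⊢_v)` generated "by forming … tensor products" of shell elements — gen-0 `shellPacketAt`; last sentence
p. 99 "with `𝒟^⊢` replaced by `𝓕` … by applying the natural poly-isomorphisms"): if every factor isomorphism `e_{α,v}` carries
`I_{α,v}` into `I'_{α,v}` and its inverse carries `I'` into `I`, then `congrAlg e` maps `shellPacketAt I` onto `shellPacketAt I'`.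
PROVED (generators to generators, both ways). [cite: Mochizuki2012, Prop. 3.2 (ii) p.98] [claim: Mochizuki2012, status: disputed] -/
theorem map_shellPacketAt_congrAlg (hI : ∀ α v x, x ∈ I α v → e α v x ∈ I' α v)
    (hI' : ∀ α v x, x ∈ I' α v → (e α v).symm x ∈ I α v) (α : A) (v : Vfib) :
    (shellPacketAt 𝕜 L I α v).map (PacketAt.congrAlg 𝕜 L L' e α v).toAddMonoidHom = shellPacketAt 𝕜 L' I' α v := by
  apply le_antisymm
  · rw [AddSubgroup.map_le_iff_le_comap, shellPacketAt, AddSubgroup.closure_le]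
    rintro _ ⟨x, y, hx, hy, rfl⟩
    rw [SetLike.mem_coe, AddSubgroup.mem_comap]
    change PacketAt.congrAlg 𝕜 L L' e α v (x ⊗ₜ[𝕜] tprod 𝕜 y) ∈ shellPacketAt 𝕜 L' I' α v
    rw [PacketAt.congrAlg_tmul_tprod]
    refine AddSubgroup.subset_closure ⟨e α v x, fun β => Packet1.congrAlg 𝕜 L L' e β.1 (y β), hI _ _ _ hx,
      fun β => ?_, rfl⟩
    exact (AddSubgroup.mem_pi _).mpr fun w _ => hI _ _ _ ((AddSubgroup.mem_pi _).mp (hy β) w trivial)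
  · rw [shellPacketAt, AddSubgroup.closure_le]
    rintro _ ⟨x', y', hx', hy', rfl⟩
    refine ⟨(e α v).symm x' ⊗ₜ[𝕜] tprod 𝕜 (fun β : {β : A // β ≠ α} => fun w => (e β.1 w).symm (y' β w)),
      AddSubgroup.subset_closure ⟨_, _, hI' _ _ _ hx', fun β => ?_, rfl⟩, ?_⟩
    · exact (AddSubgroup.mem_pi _).mpr fun w _ => hI' _ _ _ ((AddSubgroup.mem_pi _).mp (hy' β) w trivial)
    · change PacketAt.congrAlg 𝕜 L L' e α v (_ ⊗ₜ[𝕜] tprod 𝕜 _) = x' ⊗ₜ[𝕜] tprod 𝕜 y'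
      rw [PacketAt.congrAlg_tmul_tprod, AlgEquiv.apply_symm_apply]
      congr 1
      congr 1
      funext β w
      exact (e β.1 w).apply_symm_apply (y' β w)

/-- Same, for shells given as the additive subgroups GENERATED by sets `S_{α,v}` (the tree's log-shells are sets
`logShell`, entering the packets through `AddSubgroup.closure`, gen 4's `lgpShell`): `e '' S = S'` factorwise suffices.
[cite: Mochizuki2012, Prop. 3.2 (ii) p.98] [claim: Mochizuki2012, status: disputed] -/
theorem map_shellPacketAt_congrAlg_closure (S : ∀ α v, Set (L α v)) (S' : ∀ α v, Set (L' α v))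
    (hS : ∀ α v, e α v '' S α v = S' α v) (α : A) (v : Vfib) :
    (shellPacketAt 𝕜 L (fun α v => AddSubgroup.closure (S α v)) α v).map
        (PacketAt.congrAlg 𝕜 L L' e α v).toAddMonoidHom =
      shellPacketAt 𝕜 L' (fun α v => AddSubgroup.closure (S' α v)) α v := by
  have hmap : ∀ α v, (AddSubgroup.closure (S α v)).map (e α v : L α v →+ L' α v) = AddSubgroup.closure (S' α v) :=
    fun α v => by rw [AddMonoidHom.map_closure, ← hS]; rfl
  refine map_shellPacketAt_congrAlg 𝕜 L L' e _ _ (fun α v x hx => ?_) (fun α v x hx => ?_) α v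
  · rw [← hmap]
    exact AddSubgroup.mem_map_of_mem _ hx
  · rw [← hmap, AddSubgroup.mem_map] at hx
    obtain ⟨y, hy, rfl⟩ := hx
    change (e α v).symm (e α v y) ∈ _
    rwa [AlgEquiv.symm_apply_apply]

end Shells

/-! ### 3. The LGP packet log-shells `𝓘(^{S^±_{j+1},j}𝓕_v)` under the Kummer transport -/

section LGPShells

variable (p : ℕ) [Fact p.Prime] {Vfib : Type v'}
variable (K : Vfib → Type w) [∀ v, NontriviallyNormedField (K v)] [∀ v, Algebra ℚ_[p] (K v)]
variable (K' : Vfib → Type w) [∀ v, NontriviallyNormedField (K' v)] [∀ v, Algebra ℚ_[p] (K' v)]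
variable (Lg : ∀ v, PadicLogOnUnits (K v)) (Lg' : ∀ v, PadicLogOnUnits (K' v))
variable {lstar : ℕ}

/-- **The Kummer transport of Prop. 3.5 (i) carries `𝓘(^{S^±_{j+1},j;(n,m−1)}𝓕_v)` ONTO the coric `𝓘(^{S^±_{j+1},j}𝓕(^{n,∘}𝔇_≻)_v)`**
(gen 4's `lgpShell` on both sides) as soon as the identifications `e_w` of the 𝓕-prime-strip fields carry the local log-shells
`ℐ_w` onto one another (hypothesis `hshell`; discharged at the genuine logarithms below). [cite: Mochizuki2012, Prop. 3.5 (ii) p.104]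
[claim: Mochizuki2012, status: disputed] -/
theorem map_lgpShell_lgpPacketCongr (e : ∀ v, K' v ≃ₐ[ℚ_[p]] K v)
    (hshell : ∀ w, e w '' logShell (Lg' w) = logShell (Lg w)) (v : Vfib) (j : Fin lstar) :
    (lgpShell p K' Lg' v j).map (lgpPacketCongr p K K' e v j).toAddMonoidHom = lgpShell p K Lg v j :=
  map_shellPacketAt_congrAlg_closure ℚ_[p] (capsuleFields K' (labelNat j)) (capsuleFields K (labelNat j))
    (fun _ w => e w) (fun _ w => logShell (Lg' w)) (fun _ w => logShell (Lg w)) (fun _ w => hshell w)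
    (Fin.last (labelNat j)) v

end LGPShells

/-! #### … discharged at the genuine `p`-adic logarithms for ISOMETRIC identifications -/

section Genuine

variable (p : ℕ) [Fact p.Prime] {Vfib : Type v'}
variable (K : Vfib → Type w) [∀ v, NontriviallyNormedField (K v)] [∀ v, NormedAlgebra ℚ_[p] (K v)]
  [∀ v, IsUltrametricDist (K v)] [∀ v, CompleteSpace (K v)]
variable (K' : Vfib → Type w) [∀ v, NontriviallyNormedField (K' v)] [∀ v, NormedAlgebra ℚ_[p] (K' v)]
  [∀ v, IsUltrametricDist (K' v)] [∀ v, CompleteSpace (K' v)]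
variable {lstar : ℕ}

/-- **`map_lgpShell_lgpPacketCongr` DISCHARGED at the genuine `p`-adic logarithms**: for isometric identifications `e_w` the
Kummer transport carries the genuine packet log-shell of the index-`m` copy ONTO the coric one (abc-iut-w5-d242's
`image_logShell_ofUnitLog`, [IUTchIII] Prop. 1.2 (vi), in each factor) — no hypothesis on the shells left.
[cite: Mochizuki2012, Prop. 3.5 (ii) p.104] [claim: Mochizuki2012, status: disputed] -/
theorem map_lgpShell_lgpPacketCongr_ofUnitLog (e : ∀ v, K' v ≃ₐ[ℚ_[p]] K v) (he : ∀ v x, ‖e v x‖ = ‖x‖)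
    (v : Vfib) (j : Fin lstar) :
    (lgpShell p K' (fun w => PadicLogOnUnits.ofUnitLog p (K' w)) v j).map (lgpPacketCongr p K K' e v j).toAddMonoidHom =
      lgpShell p K (fun w => PadicLogOnUnits.ofUnitLog p (K w)) v j :=
  map_lgpShell_lgpPacketCongr p K K' _ _ e
    (fun w => Literature.IUT.LogVolume.image_logShell_ofUnitLog p (e w).toRingEquiv (he w)) v j

end Genuine

/-! ### 4. Prop. 3.5 (ii)(a) HOLDS for the Kummer isomorphisms CONSTRUCTED in (i) (genuine logs, isometric identifications) -/

section Prop35iiA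

variable (p : ℕ) [Fact p.Prime] {Vfib : Type v'} [Fintype Vfib]
variable (K : Vfib → Type w) [∀ v, NontriviallyNormedField (K v)] [∀ v, NormedAlgebra ℚ_[p] (K v)]
  [∀ v, IsUltrametricDist (K v)] [∀ v, ProperSpace (K v)]
variable (Km : ℤ → Vfib → Type w) [∀ m v, NontriviallyNormedField (Km m v)] [∀ m v, NormedAlgebra ℚ_[p] (Km m v)]
  [∀ m v, IsUltrametricDist (Km m v)] [∀ m v, ProperSpace (Km m v)]
variable {lstar : ℕ} (e : ∀ m v, Km m v ≃ₐ[ℚ_[p]] K v)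

open Classical in
/-- **[IUTchIII] Prop. 3.5 (ii)(a) HOLDS FOR THE KUMMER ISOMORPHISMS CONSTRUCTED IN (i)** (p. 104 l. 36 – p. 105 l. 10 "the
topological module `𝓘(^{S^±_{j+1}}𝓕(^{n,∘}𝔇_≻)_{v_ℚ})` … contains the images of … the groups of units … via both the tensor product …
of the [relevant] Kummer isomorphisms of (i), and the tensor product … of the pre-composite of these Kummer isomorphisms with
the `m'`-th iterates … of the log-links, for `m' ≥ 1`, of the `n`-th column"): my gen-0 predicate `Prop35ii_a` (p403950) with
`X :=` the CORIC label-`j` packet `log(^{S^±_{j+1},j}𝓕(^{n,∘}𝔇_≻)_v)`, `I :=` its GENUINE packet log-shell, `U m :=` the unit groups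
`∏_{β,w} 𝒪^×_{Km_{m,w}}` of the index-`m` Frobenius-like fields, **`κ m :=` the Kummer transport `lgpPacketCongr (e m)` of p432850** on
the pure tensors of units, `lam m m' :=` transport of the pure tensors of `m'`-th `log_p`-iterates where defined. PROVED for
every ISOMETRIC family `e` — my gen-2 `prop35ii_a_shellPacketAt_ofUnitLog` (p409844: units / iterates land in the
index-`m` shell) followed by `map_lgpShell_lgpPacketCongr_ofUnitLog`. [cite: Mochizuki2012, Prop. 3.5 (ii) p.104]
[claim: Mochizuki2012, status: disputed] -/
theorem prop35ii_a_lgpPacketCongr_ofUnitLog (he : ∀ m v x, ‖e m v x‖ = ‖x‖) (v : Vfib) (j : Fin lstar) :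
    Prop35ii_a (X := LGPPacket p K v j)
      (lgpShell p K (fun w => PadicLogOnUnits.ofUnitLog p (K w)) v j : Set (LGPPacket p K v j))
      (fun m : ℤ => ∀ (β : Fin (labelNat j + 1)) (w : Vfib), ↥(sphere (0 : Km m w) 1))
      (fun m u => lgpPacketCongr p K (Km m) (e m) v j
        ((u (Fin.last (labelNat j)) v : Km m v) ⊗ₜ[ℚ_[p]]
          tprod ℚ_[p] fun β : {β : Fin (labelNat j + 1) // β ≠ Fin.last (labelNat j)} => fun w =>
            (u β.1 w : Km m w)))
      (fun m (m' : ℕ) _ u =>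
        if ∀ β w, (u β w : Km m w) ∈ iterDomain (PadicLogOnUnits.ofUnitLog p (Km m w)) m' then
          some (lgpPacketCongr p K (Km m) (e m) v j
            ((PadicLogOnUnits.ofUnitLog p (Km m v)).log^[m'] (u (Fin.last (labelNat j)) v : Km m v) ⊗ₜ[ℚ_[p]]
              tprod ℚ_[p] fun β : {β : Fin (labelNat j + 1) // β ≠ Fin.last (labelNat j)} => fun w =>
                (PadicLogOnUnits.ofUnitLog p (Km m w)).log^[m'] (u β.1 w : Km m w)))
        else none) := by
  have hsh := fun m => map_lgpShell_lgpPacketCongr_ofUnitLog p K (Km m) (e m) (he m) v j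
  have hw := fun m =>
    prop35ii_a_shellPacketAt_ofUnitLog p (capsuleFields (Km m) (labelNat j)) (Fin.last (labelNat j)) v
  refine ⟨fun m u => ?_, fun m m' hm u x hx => ?_⟩
  · rw [← hsh m]
    exact AddSubgroup.mem_map_of_mem _ ((hw m).1 m u)
  · dsimp only at hx
    split_ifs at hx with hu
    rw [Option.some.injEq] at hx
    subst hx
    rw [← hsh m]
    refine AddSubgroup.mem_map_of_mem _ ((hw m).2 m m' hm u _ ?_)
    dsimp only
    rw [if_pos hu]

end Prop35iiA

/-! ### 5. Functoriality of the Kummer transports: the composite between two vertical indices -/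

section KummerFunctorial

variable (p : ℕ) [Fact p.Prime] {Vfib : Type v'}
variable (K : Vfib → Type w) [∀ v, NontriviallyNormedField (K v)] [∀ v, Algebra ℚ_[p] (K v)]
variable (K' : Vfib → Type w) [∀ v, NontriviallyNormedField (K' v)] [∀ v, Algebra ℚ_[p] (K' v)]
variable (K'' : Vfib → Type w) [∀ v, NontriviallyNormedField (K'' v)] [∀ v, Algebra ℚ_[p] (K'' v)]
variable {lstar : ℕ}

/-- The Kummer transport along composite identifications is the composite transport. [cite: Mochizuki2012, Prop. 3.5 (i) p.104]
[claim: Mochizuki2012, status: disputed] -/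
theorem lgpPacketCongr_trans (e : ∀ v, K'' v ≃ₐ[ℚ_[p]] K' v) (e' : ∀ v, K' v ≃ₐ[ℚ_[p]] K v) (v : Vfib)
    (j : Fin lstar) :
    lgpPacketCongr p K K'' (fun v => (e v).trans (e' v)) v j =
      (lgpPacketCongr p K' K'' e v j).trans (lgpPacketCongr p K K' e' v j) :=
  PacketAt.congrAlg_trans ℚ_[p] (capsuleFields K'' (labelNat j)) (capsuleFields K' (labelNat j))
    (capsuleFields K (labelNat j)) (fun _ w => e w) (fun _ w => e' w) (Fin.last (labelNat j)) v

/-- The inverse Kummer transport is the transport along the inverse identifications. [cite: Mochizuki2012, Prop. 3.5 (i) p.104]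
[claim: Mochizuki2012, status: disputed] -/
theorem lgpPacketCongr_symm (e : ∀ v, K' v ≃ₐ[ℚ_[p]] K v) (v : Vfib) (j : Fin lstar) :
    (lgpPacketCongr p K K' e v j).symm = lgpPacketCongr p K' K (fun v => (e v).symm) v j :=
  PacketAt.congrAlg_symm ℚ_[p] (capsuleFields K' (labelNat j)) (capsuleFields K (labelNat j)) (fun _ w => e w)
    (Fin.last (labelNat j)) v

/-- **Two vertical indices**: "index `m` ⥲ coric ⥲ index `m'`" is the transport along the composite identification
`e_{m'}⁻¹ ∘ e_m` of the two Frobenius-like copies — the cocycle making the `ℤ`-indexed family of Kummer isomorphisms of (i)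
consistent ("translation symmetries of the `n`-th column", p. 106). [cite: Mochizuki2012, Prop. 3.5 (i) p.104]
[claim: Mochizuki2012, status: disputed] -/
theorem lgpPacketCongr_trans_symm (e : ∀ v, K' v ≃ₐ[ℚ_[p]] K v) (e'' : ∀ v, K'' v ≃ₐ[ℚ_[p]] K v) (v : Vfib)
    (j : Fin lstar) :
    (lgpPacketCongr p K K' e v j).trans (lgpPacketCongr p K K'' e'' v j).symm =
      lgpPacketCongr p K'' K' (fun v => (e v).trans (e'' v).symm) v j := by
  rw [lgpPacketCongr_symm, ← lgpPacketCongr_trans]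

end KummerFunctorial

section KummerColumn

variable (p : ℕ) [Fact p.Prime] {Vfib : Type v'} [Fintype Vfib]
variable (K : Vfib → Type w) [∀ v, NontriviallyNormedField (K v)] [∀ v, Algebra ℚ_[p] (K v)]
  [∀ v, IsBoundedSMul ℚ_[p] (K v)] [∀ v, IsUltrametricDist (K v)] [∀ v, CharZero (K v)]
variable (Lg : ∀ v, PadicLogOnUnits (K v))
variable (Km : ℤ → Vfib → Type w) [∀ m v, NontriviallyNormedField (Km m v)] [∀ m v, Algebra ℚ_[p] (Km m v)]
  [∀ m v, IsBoundedSMul ℚ_[p] (Km m v)] [∀ m v, IsUltrametricDist (Km m v)] [∀ m v, CharZero (Km m v)]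
variable (Lgm : ∀ m v, PadicLogOnUnits (Km m v))
variable {lstar : ℕ} (isBad : Vfib → Prop)
variable (M : Vfib → Type w') [∀ v, CommMonoid (M v)]
variable (Γ : Vfib → Type w₃) [∀ v, Monoid (Γ v)] [∀ v, MulDistribMulAction (Γ v) (M v)]
variable (ι : ∀ v, M v →* K v)
variable (gau gauInf : ∀ v, Submonoid (Fin lstar → M v)) (split : ∀ v, isBad v → Submonoid (Fin lstar → M v))
variable (split_le : ∀ v (h : isBad v), split v h ≤ gau v)
variable (Mm : ℤ → Vfib → Type w') [∀ m v, CommMonoid (Mm m v)] [∀ m v, MulDistribMulAction (Γ v) (Mm m v)]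
variable (ιm : ∀ m v, Mm m v →* Km m v)
variable (gaum gauInfm : ∀ m v, Submonoid (Fin lstar → Mm m v))
variable (splitm : ∀ m v, isBad v → Submonoid (Fin lstar → Mm m v))
variable (splitm_le : ∀ m v (h : isBad v), splitm m v h ≤ gaum m v)
variable (κ : ∀ m v, Mm m v ≃* M v) (e : ∀ m v, Km m v ≃ₐ[ℚ_[p]] K v)
variable (hcompat : ∀ m v x, e m v (ιm m v x) = ι v (κ m v x))
    (hgau : ∀ m v, (gaum m v).map (piIso (Fin lstar) (κ m v)).toMonoidHom = gau v)
    (hgauInf : ∀ m v, (gauInfm m v).map (piIso (Fin lstar) (κ m v)).toMonoidHom = gauInf v)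

/-- **The composite Kummer isomorphism `Ψ_{𝓕_LGP}(^{n,m})_{v,j} ⥲ Ψ_LGP(^{n,∘})_{v,j} ⥲ Ψ_{𝓕_LGP}(^{n,m'})_{v,j}` of
`VerticallyCoricLGPData.ofKummer` (p432850) IS the Kummer transport along the composite identification `e_{m'}⁻¹ ∘ e_m`,
restricted** (p432850's `ofKummer_kummer_trans_coe` + `lgpPacketCongr_trans_symm`): the `ℤ`-indexed family of Kummer
isomorphisms of (i) is a consistent system of identifications through the vertically coric copy. PROVED.
[cite: Mochizuki2012, Prop. 3.5 (i) p.104] [claim: Mochizuki2012, status: disputed] -/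
theorem VerticallyCoricLGPData.ofKummer_kummer_trans_eq_congr (m m' : ℤ) (v : Vfib) (j : Fin lstar)
    (x : (VerticallyCoricLGPData.ofKummer p K Lg Km Lgm isBad M Γ ι gau gauInf split split_le Mm ιm gaum gauInfm
      splitm splitm_le κ e hcompat hgau hgauInf).ΨF m v j) :
    let D := VerticallyCoricLGPData.ofKummer p K Lg Km Lgm isBad M Γ ι gau gauInf split split_le Mm ιm gaum gauInfm
      splitm splitm_le κ e hcompat hgau hgauInf
    (((D.kummer m v j).trans (D.kummer m' v j).symm x : D.ΨF m' v j) : LGPPacket p (Km m') v j) =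
      lgpPacketCongr p (Km m') (Km m) (fun w => (e m w).trans (e m' w).symm) v j (x : LGPPacket p (Km m) v j) := by
  rw [← lgpPacketCongr_trans_symm]
  rfl

end KummerColumn

end Literature.IUT.LogThetaLattice

end
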